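import Summits.Ventures.PercRepro.S1EightSixSeparators

/-!
# PercRepro — THE RANK PROFILE OF A COLOOP-FREE SIMPLE RANK-7 MATROID ON 11 POINTS BY SIZES (p2, gen 28;
SUBCLAIM-S1 §6.10 (xvii)(q); towards the `(9, 6)` shapes — the corank-`4` part of rank `7`)

Closures of pairs have `≤ 5` points (`c = 3`), so a rank-`n` set (`n < 7`) has `≤ n + 3` points. The `k`-sets
(`2 ≤ k ≤ 10`) are partitioned by rank into `rankTwoSets k`, `rkSets k 3`, …, `rkSets k 7`; the emptiness by size
and by rank; the partitions as lower bounds `C(11, k) ≤ Σ`. Nothing is claimed about any cell.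

* `eRk_bounds_rank_seven_eleven`, `mem_rank_classes_eleven`, `choose_le_rank_classes_eleven`,
  `rkSets_eq_empty_of_big_eleven`, `rankTwoSets_eq_empty_of_big_eleven`, `rank_classes_eleven`.
Axioms: standard.
-/

open scoped Matroid

namespace PercRepro

namespace S1

open Set

variable {α : Type}

section RankSevenOnEleven

variable {M : Matroid α} [M.Finite]

/-- The rank of a `k`-set as a natural with its bounds, on `11` points of rank `7`. -/
theorem eRk_bounds_rank_seven_eleven (hM : M.eRank = ((7 : ℕ) : ℕ∞)) (hE : M.E.ncard = 11) (hcol : M.coloops = ∅)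
    (hpairs : ∀ e ∈ M.E, ∀ f ∈ M.E, e ≠ f → M.eRk {e, f} = 2) {X : Set α} (hX : X ⊆ M.E) (h2 : 2 ≤ X.ncard) :
    ∃ n : ℕ, M.eRk X = (n : ℕ∞) ∧ 2 ≤ n ∧ n ≤ 7 ∧ n ≤ X.ncard ∧ (n < 7 → X.ncard + (7 - n + 1) ≤ 11) := by
  have hhi : M.eRk X ≤ M.eRank := M.eRk_le_eRank X
  rw [hM] at hhi
  obtain ⟨n, hn⟩ := ENat.ne_top_iff_exists.mp (ne_top_of_le_ne_top (by decide) hhi)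
  have hlo := two_le_eRk_of_two_le_ncard hpairs hX h2
  have hsize : M.eRk X ≤ (X.ncard : ℕ∞) := by
    have := M.eRk_le_encard X
    rwa [← (M.ground_finite.subset hX).cast_ncard_eq] at this
  rw [← hn] at hlo hhi hsize
  refine ⟨n, hn.symm, by exact_mod_cast hlo, by exact_mod_cast hhi, by exact_mod_cast hsize, fun h => ?_⟩
  have hmiss := sub_add_one_le_ncard_ground_sdiff_of_coloops M hM hcol hX hn.symm h
  rw [ncard_sdiff' hX M.ground_finite, hE] at hmiss
  have := ncard_le_ncard hX M.ground_finite
  rw [hE] at this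
  omega

/-- A `k`-set (`k ≥ 2`) lies in one of the six rank classes. -/
theorem mem_rank_classes_eleven (hM : M.eRank = ((7 : ℕ) : ℕ∞)) (hE : M.E.ncard = 11) (hcol : M.coloops = ∅)
    (hpairs : ∀ e ∈ M.E, ∀ f ∈ M.E, e ≠ f → M.eRk {e, f} = 2) {X : Set α} (hX : X ⊆ M.E) (h2 : 2 ≤ X.ncard) :
    X ∈ rankTwoSets M X.ncard ∪ rkSets M X.ncard 3 ∪ rkSets M X.ncard 4 ∪ rkSets M X.ncard 5 ∪
      rkSets M X.ncard 6 ∪ rkSets M X.ncard 7 := by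
  obtain ⟨n, hn, hn2, hn7, -, -⟩ := eRk_bounds_rank_seven_eleven hM hE hcol hpairs hX h2
  have key : ∀ m : ℕ, n = m → X ∈ rkSets M X.ncard m := fun m hm => ⟨hX, rfl, by rw [hn, hm]⟩
  rcases Nat.lt_or_ge n 3 with h | h
  · left; left; left; left; left; refine ⟨hX, rfl, ?_⟩; rw [hn]; have : n = 2 := by omega
    rw [this]; rfl
  rcases Nat.lt_or_ge n 4 with h' | h'
  · left; left; left; left; right; exact key 3 (by omega)
  rcases Nat.lt_or_ge n 5 with h'' | h''
  · left; left; left; right; exact key 4 (by omega)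
  rcases Nat.lt_or_ge n 6 with h3 | h3
  · left; left; right; exact key 5 (by omega)
  rcases Nat.lt_or_ge n 7 with h4 | h4
  · left; right; exact key 6 (by omega)
  · right; exact key 7 (by omega)

/-- The `k`-sets are covered by the six rank classes. -/
theorem choose_le_rank_classes_eleven (hM : M.eRank = ((7 : ℕ) : ℕ∞)) (hE : M.E.ncard = 11) (hcol : M.coloops = ∅)
    (hpairs : ∀ e ∈ M.E, ∀ f ∈ M.E, e ≠ f → M.eRk {e, f} = 2) (k : ℕ) (hk : 2 ≤ k) :
    Nat.choose 11 k ≤ (rankTwoSets M k).ncard + (rkSets M k 3).ncard + (rkSets M k 4).ncard +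
      (rkSets M k 5).ncard + (rkSets M k 6).ncard + (rkSets M k 7).ncard := by
  have hsub : {A : Set α | A ⊆ M.E ∧ A.ncard = k} ⊆
      rankTwoSets M k ∪ rkSets M k 3 ∪ rkSets M k 4 ∪ rkSets M k 5 ∪ rkSets M k 6 ∪ rkSets M k 7 := by
    rintro A ⟨hAE, hAk⟩
    have := mem_rank_classes_eleven hM hE hcol hpairs hAE (by omega)
    rwa [hAk] at this
  have h := ncard_le_ncard hsub (((((rankTwoSets_finite M k).union (rkSets_finite k 3)).union (rkSets_finite k 4)).union
    (rkSets_finite k 5) |>.union (rkSets_finite k 6)) |>.union (rkSets_finite k 7))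
  rw [ncard_setOf_subset_ncard_eq M.ground_finite k, hE] at h
  refine h.trans ((ncard_union_le _ _).trans ?_)
  refine Nat.add_le_add_right ((ncard_union_le _ _).trans ?_) _
  refine Nat.add_le_add_right ((ncard_union_le _ _).trans ?_) _
  refine Nat.add_le_add_right ((ncard_union_le _ _).trans ?_) _
  exact Nat.add_le_add_right (ncard_union_le _ _) _

/-- A rank-`n` set (`n < 7`) has at most `n + 3` points. -/
theorem rkSets_eq_empty_of_big_eleven (hM : M.eRank = ((7 : ℕ) : ℕ∞)) (hE : M.E.ncard = 11) (hcol : M.coloops = ∅)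
    {k n : ℕ} (hn : n < 7) (hk : 11 < k + (7 - n + 1)) : rkSets M k n = ∅ := by
  rw [eq_empty_iff_forall_notMem]
  rintro X ⟨hXE, hXk, hXn⟩
  have hmiss := sub_add_one_le_ncard_ground_sdiff_of_coloops M hM hcol hXE hXn hn
  rw [ncard_sdiff' hXE M.ground_finite, hE, hXk] at hmiss
  have := ncard_le_ncard hXE M.ground_finite
  rw [hE] at this
  omega

/-- No rank-`2` set has more than `5` points. -/
theorem rankTwoSets_eq_empty_of_big_eleven (hM : M.eRank = ((7 : ℕ) : ℕ∞)) (hE : M.E.ncard = 11)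
    (hcol : M.coloops = ∅) {k : ℕ} (hk : 5 < k) : rankTwoSets M k = ∅ := by
  rw [eq_empty_iff_forall_notMem]
  rintro X ⟨hXE, hXk, hX2⟩
  have hX2' : M.eRk X = ((2 : ℕ) : ℕ∞) := hX2
  have hmiss := sub_add_one_le_ncard_ground_sdiff_of_coloops M hM hcol hXE hX2' (by norm_num)
  rw [ncard_sdiff' hXE M.ground_finite, hE, hXk] at hmiss
  have := ncard_le_ncard hXE M.ground_finite
  rw [hE] at this
  omega

/-- The partitions of the `k`-sets by rank, `k = 3, …, 10`, with the empty classes removed: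
`3`-sets: `t + r₃₃ ≥ 165`; `4`: `q₂ + r₄₃ + r₄₄ ≥ 330`; `5`: `p₅ + r₅₃ + r₅₄ + r₅₅ ≥ 462`;
`6`: `r₆₃ + r₆₄ + r₆₅ + r₆₆ ≥ 462`; `7`: `r₇₄ + r₇₅ + r₇₆ + s₇ ≥ 330`; `8`: `r₈₅ + r₈₆ + s₈ ≥ 165`;
`9`: `r₉₆ + s₉ ≥ 55`; `10`: `s₁₀ ≥ 11`. -/
theorem rank_classes_eleven (hM : M.eRank = ((7 : ℕ) : ℕ∞)) (hE : M.E.ncard = 11) (hcol : M.coloops = ∅)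
    (hpairs : ∀ e ∈ M.E, ∀ f ∈ M.E, e ≠ f → M.eRk {e, f} = 2) :
    165 ≤ (rankTwoSets M 3).ncard + (rkSets M 3 3).ncard ∧
    330 ≤ (rankTwoSets M 4).ncard + (rkSets M 4 3).ncard + (rkSets M 4 4).ncard ∧
    462 ≤ (rankTwoSets M 5).ncard + (rkSets M 5 3).ncard + (rkSets M 5 4).ncard + (rkSets M 5 5).ncard ∧
    462 ≤ (rkSets M 6 3).ncard + (rkSets M 6 4).ncard + (rkSets M 6 5).ncard + (rkSets M 6 6).ncard ∧
    330 ≤ (rkSets M 7 4).ncard + (rkSets M 7 5).ncard + (rkSets M 7 6).ncard + (rkSets M 7 7).ncard ∧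
    165 ≤ (rkSets M 8 5).ncard + (rkSets M 8 6).ncard + (rkSets M 8 7).ncard ∧
    55 ≤ (rkSets M 9 6).ncard + (rkSets M 9 7).ncard ∧
    11 ≤ (rkSets M 10 7).ncard := by
  have e_lt : ∀ {k n : ℕ}, k < n → rkSets M k n = ∅ := fun h => rkSets_eq_empty_of_lt h
  have e_big := fun {k n : ℕ} (hn : n < 7) (hk : 11 < k + (7 - n + 1)) =>
    rkSets_eq_empty_of_big_eleven hM hE hcol (k := k) (n := n) hn hk
  have e_two := fun {k : ℕ} (hk : 5 < k) => rankTwoSets_eq_empty_of_big_eleven hM hE hcol (k := k) hk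
  refine ⟨?_, ?_, ?_, ?_, ?_, ?_, ?_, ?_⟩
  · have := choose_le_rank_classes_eleven hM hE hcol hpairs 3 (by norm_num)
    rw [e_lt (k := 3) (n := 4) (by norm_num), e_lt (k := 3) (n := 5) (by norm_num), e_lt (k := 3) (n := 6) (by norm_num),
      e_lt (k := 3) (n := 7) (by norm_num), ncard_empty, show Nat.choose 11 3 = 165 by decide] at this
    omega
  · have := choose_le_rank_classes_eleven hM hE hcol hpairs 4 (by norm_num)
    rw [e_lt (k := 4) (n := 5) (by norm_num), e_lt (k := 4) (n := 6) (by norm_num), e_lt (k := 4) (n := 7) (by norm_num),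
      ncard_empty, show Nat.choose 11 4 = 330 by decide] at this
    omega
  · have := choose_le_rank_classes_eleven hM hE hcol hpairs 5 (by norm_num)
    rw [e_lt (k := 5) (n := 6) (by norm_num), e_lt (k := 5) (n := 7) (by norm_num), ncard_empty,
      show Nat.choose 11 5 = 462 by decide] at this
    omega
  · have := choose_le_rank_classes_eleven hM hE hcol hpairs 6 (by norm_num)
    rw [e_two (k := 6) (by norm_num), e_lt (k := 6) (n := 7) (by norm_num), ncard_empty,
      show Nat.choose 11 6 = 462 by decide] at this
    omega
  · have := choose_le_rank_classes_eleven hM hE hcol hpairs 7 (by norm_num)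
    rw [e_two (k := 7) (by norm_num), e_big (k := 7) (n := 3) (by norm_num) (by norm_num), ncard_empty,
      show Nat.choose 11 7 = 330 by decide] at this
    omega
  · have := choose_le_rank_classes_eleven hM hE hcol hpairs 8 (by norm_num)
    rw [e_two (k := 8) (by norm_num), e_big (k := 8) (n := 3) (by norm_num) (by norm_num),
      e_big (k := 8) (n := 4) (by norm_num) (by norm_num), ncard_empty, show Nat.choose 11 8 = 165 by decide] at this
    omega
  · have := choose_le_rank_classes_eleven hM hE hcol hpairs 9 (by norm_num)
    rw [e_two (k := 9) (by norm_num), e_big (k := 9) (n := 3) (by norm_num) (by norm_num),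
      e_big (k := 9) (n := 4) (by norm_num) (by norm_num), e_big (k := 9) (n := 5) (by norm_num) (by norm_num),
      ncard_empty, show Nat.choose 11 9 = 55 by decide] at this
    omega
  · have := choose_le_rank_classes_eleven hM hE hcol hpairs 10 (by norm_num)
    rw [e_two (k := 10) (by norm_num), e_big (k := 10) (n := 3) (by norm_num) (by norm_num),
      e_big (k := 10) (n := 4) (by norm_num) (by norm_num), e_big (k := 10) (n := 5) (by norm_num) (by norm_num),
      e_big (k := 10) (n := 6) (by norm_num) (by norm_num), ncard_empty, show Nat.choose 11 10 = 11 by decide] at this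
    omega

end RankSevenOnEleven

end S1

end PercRepro
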